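import Summits.QuantumFields.BalabanUV.Gaps.D1SymbolSmallMomentumGerm
import Summits.QuantumFields.BalabanUV.Gaps.D1WardTraceForm

/-!
# `BalabanUV.Gaps.D1SymbolTraceGerm` — cell pub-balaban-gaps, row (D1), seat g1-p1: THE SMALL-MOMENTUM GERM OF THE SYMBOL FORM IN ANY DIRECTION IS THE CONTRACTED SECOND-MOMENT TENSOR,
# and THE TRACE GERM along an axis is the ROW SUM of the (1.22) matrix — `(Σ_ν Σ_z P_{νν}(z) cos(p z_α))∕p² → Σ_{ν≠α} β_{αν} = −½ Σ_z P_{αα}(z)|z|²` — whose axis sum is rows 88–90's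
# axis-order-blind trace scalar `−½ Σ_ν Σ_z P_{νν}(z)|z|² = Σ_{a≠b} β_{ab}`; hypothesis-free at an2's chart-(II) literal, under `hW_j` at the pinned ∕ (III′) literals

HONEST FRAMING (cell rule, page 1 of everything): [folklore] — the Tannery-at-zero argument of row 95 (`D1SymbolSmallMomentumGerm.tendsto_tsum_cos_div_sq`, an2's `cosWeight` lemmas) run with
a general linear phase `k·z`, composed BY NAME with row 95's diagonal germ, leaf-01's `sqMoment_self_eq_zero_of_ward` ((5.9): `Σ_z P_{αα}(z) z_α² = 0`), row 88's column identity and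
channel-sum identity (`D1WardTraceForm.sum_offDiag_secondMoment_col ∕ _eq_trace`), (5.8)'s `secondMoment_comm`, an2's `symmetries_JsRowD1Pin`, GEN 14's dictionaries.  (5.16) p. 293 is
PRINTED for Bałaban's Π and NOT used: the germ proved here is the GENERAL contracted second-moment tensor `Σ_z P_{μν}(z) z_α z_γ` (no (1.21), no single `β`); only on the diagonal ∕ axis
entries is it identified with (1.22) coefficients.  NOTHING of Bałaban's is asserted; no symbol is computed or certified; the Ward binder `hW_j` at the pinned ∕ (III′) literals REMAINS a
hypothesis; NO coefficient of Bałaban's computed or signed; (D1) NOT discharged; 0∕4 row-D1 binders at the pinned ∕ (III′) literals; NOT `BetaPertH`, NOT continuum, NOT Clay.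
HONEST DEPENDENCY (b2b cell, verbatim): «continuum YM on T⁴ ⇐ BetaPertH ∧ nine spine estimates (0/9 proved); BetaPertH ⇐ (D1) ∧ (D4) ∧ CAP+tail; G-an2-4 gates asym, D1 and NE2/3/4.»

WHY (census row 97 of `HOME/g1/RESIDUE.md`).  Row 95 read ONE diagonal entry along ONE axis.  GEN 18's by-value screen (RESULT-6) read the symbol in GENERIC small directions and its
isotropic part («`K̂(k) ≈ m₀·1 + β⁰₀(|k|²·1 − kkᵀ)`»).  This file supplies the kernel statements behind those readings WITHOUT (1.21): (i) for any REAL test vector `v` and direction `k`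
the curvature of `Re vᵀP̂(s·k)v` at `s = 0` is `−½ Σ_z Q_v(z)(k·z)²`, `Q_v = Σ_{μν} v_μ v_ν P_{μν}` — a quadratic form in `v ⊗ k` built from the second-moment tensor, in general NOT of
the (5.16) shape; (ii) along an AXIS the TRACE of the symbol has curvature `Σ_{ν≠α} β_{αν}` (the longitudinal entry is flat by (5.9)), equal to `−½ Σ_z P_{αα}(z)|z|²`; (iii) summed over the
axes this is `Σ_{a≠b} β_{ab} = −½ Σ_ν Σ_z P_{νν}(z)|z|²` — rows 88–90's axis-order-blind scalar (`= 2·Σ_{a<b} β⁰_j(a,b)`, the channel budget), now with a MOMENTUM-SPACE meaning: the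
axis-averaged small-momentum curvature of `tr P̂`.  By value (zero weight): a desk reads `Σ_{ν≠α} β⁰_j(α,ν)` off `tr K̂(h·e_α)∕h²` for each axis, and the budget off their sum.
WHAT IT IS NOT: no certificate; `hW_j` (pinned ∕ (III′)), the VALUE side of (D1), (1.21), `D1Tel` ∕ `D1Rep` untouched; the words of the row do not move.

CONTENT (all [folklore]; no `def`, no `def … : Prop`, 0 sorry): §1 `sq_phase_le`, **`tendsto_tsum_cos_phase_div_sq`** (generic `Q`, phase `k·z`); §2 **`tendsto_form_cos_div_sq`** ((5.9) + `MomentSummable P 3`,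
real `v`, any `k`); §3 `tendsto_diag_cos_div_sq_self` (the longitudinal diagonal entry is flat), **`tendsto_trace_cos_div_sq`** (`→ Σ_ν [ν ≠ α] β_{αν}`), `sum_offDiag_secondMoment_row`,
`tendsto_trace_cos_div_sq_eq_longitudinalNormSq` (`→ −½ Σ_z P_{αα}(z)|z|²`), **`tendsto_sum_trace_cos_div_sq`** (axis sum `→ −½ Σ_ν Σ_z P_{νν}(z)|z|²`); §4 literals (`d = 4`):
**`tendsto_sum_trace_cos_div_sq_JsRowD1Pin`**, `tendsto_trace_cos_div_sq_JsRowD1Pin` (hypothesis-free), `…_JsBalAn1_of_hW` (2), `…_JsB12CombShSym_of_hW` (2).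

Provenance: cell pub-balaban-gaps, seat g1-p1 GEN 19 (prover-pub-balaban-gaps-g1-p1-g19-0), 2026-08-26 (INTENT-74); imports this seat's row 95 `Gaps/D1SymbolSmallMomentumGerm` (p411607 ✓) and row 88
`Gaps/D1WardTraceForm` (p402435 ✓); no existing file touched.
-/

noncomputable section

open Complex Finset Filter Topology
open scoped ComplexConjugate BigOperators Real

namespace Summit.QuantumFields.BalabanUV.Gaps.D1SymbolTraceGerm

open Literature.MathematicalPhysics.QuantumFieldTheory.Balaban1983to89
open Literature.MathematicalPhysics.QuantumFieldTheory.Balaban1983to89.Beta.PolarizationSign (WardTransversal IndexSymmetric MomentSummable size one_le_size size_pos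
  abs_apply_le_size cosWeight cosWeight_zero sq_mul_cosWeight abs_cosWeight_le continuous_cosWeight tsum_eq_zero_of_ward secondMoment_comm)
open Summit.QuantumFields.BalabanUV.Beta.D1BFx.WardDiagonalSecondMoment (sqMoment_self_eq_zero_of_ward)
open Summit.QuantumFields.BalabanUV.Gaps.D1WardTraceForm (sum_offDiag_secondMoment_col sum_offDiag_secondMoment_eq_trace)
open Summit.QuantumFields.BalabanUV.Gaps.D1SymbolSmallMomentumGerm (tendsto_tsum_cos_div_sq tendsto_diag_cos_div_sq_secondMoment)

variable {d : ℕ}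

/-! ## §1 The germ in a general direction `k ∈ ℝ^d`: `Σ_z Q(z) cos(p k·z) = −½ (Σ_z Q(z)(k·z)²) p² + o(p²)` -/

/-- [folklore] `(k·z)² ≤ (Σ_i |k_i|)² · size(z)²`. -/
theorem sq_phase_le (k : Fin d → ℝ) (z : Fin d → ℤ) : (∑ i, k i * z i) ^ 2 ≤ (∑ i, |k i|) ^ 2 * size z ^ 2 := by
  have h : |∑ i, k i * z i| ≤ (∑ i, |k i|) * size z := by
    calc |∑ i, k i * z i| ≤ ∑ i, |k i * z i| := Finset.abs_sum_le_sum_abs _ _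
      _ ≤ ∑ i, |k i| * size z := Finset.sum_le_sum fun i _ => by
          rw [abs_mul]; exact mul_le_mul_of_nonneg_left (abs_apply_le_size z i) (abs_nonneg _)
      _ = (∑ i, |k i|) * size z := (Finset.sum_mul _ _ _).symm
  calc (∑ i, k i * z i) ^ 2 = |∑ i, k i * z i| ^ 2 := (sq_abs _).symm
    _ ≤ ((∑ i, |k i|) * size z) ^ 2 := pow_le_pow_left₀ (abs_nonneg _) h 2
    _ = (∑ i, |k i|) ^ 2 * size z ^ 2 := by ring

/-- [folklore] **TANNERY AT ZERO MOMENTUM, GENERAL DIRECTION**: if `Q` is absolutely summable with `Σ_z |Q(z)| (k·z)² < ∞` and `Σ_z Q(z) = 0`, then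
`(Σ_z Q(z) cos(p k·z)) ∕ p² → −½ Σ_z Q(z) (k·z)²` as `p → 0`, `p ≠ 0` (the axis case `k = e_α` is row 95's `tendsto_tsum_cos_div_sq`). -/
theorem tendsto_tsum_cos_phase_div_sq (Q : (Fin d → ℤ) → ℝ) (k : Fin d → ℝ) (hQ : Summable fun z => |Q z|) (h2 : Summable fun z => |Q z| * (∑ i, k i * z i) ^ 2)
    (h0 : ∑' z, Q z = 0) :
    Tendsto (fun p : ℝ => (∑' z, Q z * Real.cos (p * ∑ i, k i * z i)) / p ^ 2) (𝓝[≠] 0) (𝓝 (-(1 / 2) * ∑' z, Q z * (∑ i, k i * z i) ^ 2)) := by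
  have hQ' : Summable Q := Summable.of_norm_bounded hQ (fun z => le_rfl)
  have hcos : ∀ p : ℝ, Summable fun z => Q z * Real.cos (p * ∑ i, k i * z i) := fun p =>
    Summable.of_norm_bounded hQ fun z => by
      rw [Real.norm_eq_abs, abs_mul]; exact mul_le_of_le_one_right (abs_nonneg _) (Real.abs_cos_le_one _)
  have heq : ∀ p : ℝ, p ≠ 0 → (∑' z, Q z * Real.cos (p * ∑ i, k i * z i)) / p ^ 2 = -∑' z, Q z * cosWeight p (∑ i, k i * z i) := by
    intro p hp
    rw [div_eq_iff (pow_ne_zero 2 hp), neg_mul, ← tsum_mul_right]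
    have e : ∑' z, Q z * cosWeight p (∑ i, k i * z i) * p ^ 2 = ∑' z, (Q z - Q z * Real.cos (p * ∑ i, k i * z i)) := tsum_congr fun z => by
      rw [mul_assoc, mul_comm (cosWeight p _), sq_mul_cosWeight]; ring
    rw [e, Summable.tsum_sub hQ' (hcos p), h0, zero_sub, neg_neg]
  have hlim : Tendsto (fun p : ℝ => ∑' z, Q z * cosWeight p (∑ i, k i * z i)) (𝓝[≠] 0) (𝓝 (∑' z, Q z * ((∑ i, k i * z i) ^ 2 / 2))) := by
    refine tendsto_tsum_of_dominated_convergence (bound := fun z => |Q z| * (∑ i, k i * z i) ^ 2 / 2) ?_ (fun z => ?_) ?_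
    · simpa [mul_div_assoc] using h2.div_const 2
    · have hc : Continuous fun p : ℝ => Q z * cosWeight p (∑ i, k i * z i) := continuous_const.mul (continuous_cosWeight _)
      have ht := hc.tendsto 0
      rw [cosWeight_zero] at ht
      exact ht.mono_left nhdsWithin_le_nhds
    · refine Eventually.of_forall fun p z => ?_
      rw [Real.norm_eq_abs, abs_mul]
      calc |Q z| * |cosWeight p (∑ i, k i * z i)| ≤ |Q z| * ((∑ i, k i * z i) ^ 2 / 2) := mul_le_mul_of_nonneg_left (abs_cosWeight_le _ _) (abs_nonneg _)
        _ = |Q z| * (∑ i, k i * z i) ^ 2 / 2 := by ring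
  have hval : -(∑' z, Q z * ((∑ i, k i * z i) ^ 2 / 2)) = -(1 / 2) * ∑' z, Q z * (∑ i, k i * z i) ^ 2 := by
    rw [← tsum_mul_left, ← tsum_neg]; exact tsum_congr fun z => by ring
  rw [← hval]
  exact hlim.neg.congr' (eventually_nhdsWithin_of_forall fun p hp => (heq p hp).symm)

/-! ## §2 The germ of the symbol FORM on a real test vector, any direction: the contracted second-moment tensor -/

/-- [folklore] **THE QUADRATIC GERM OF THE SYMBOL FORM**: under (5.9) and summable third moments, for every REAL test vector `v` and direction `k`,
`(Σ_z Q_v(z) cos(p k·z)) ∕ p² → −½ Σ_z Q_v(z) (k·z)²`, `Q_v(z) := Σ_{μν} v_μ v_ν P_{μν}(z)` — the second-moment tensor `Σ_z P_{μν}(z) z_α z_γ` contracted with `v⊗v` and `k⊗k` (the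
(5.16) shape asserts this tensor is `β(δ_{μν}δ_{αγ}… )`-structured under (1.21); nothing of that is used or claimed here).  `Σ_z Q_v(z) cos(2πs k·z)` is the real part of `vᵀ P̂(s·k) v` (row 95's
`re_symbolEntry_eq_tsum_cos`, entry by entry). -/
theorem tendsto_form_cos_div_sq {P : B12Beta.Kernel d} (hP : MomentSummable P 3) (hT : WardTransversal P) (v k : Fin d → ℝ) :
    Tendsto (fun p : ℝ => (∑' z, (∑ μ, ∑ ν, v μ * v ν * P μ ν z) * Real.cos (p * ∑ i, k i * z i)) / p ^ 2) (𝓝[≠] 0)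
      (𝓝 (-(1 / 2) * ∑' z, (∑ μ, ∑ ν, v μ * v ν * P μ ν z) * (∑ i, k i * z i) ^ 2)) := by
  have habs : ∀ μ ν, Summable fun z => |v μ * v ν * P μ ν z| := fun μ ν => by
    simpa only [abs_mul, mul_assoc] using ((hP.summable_abs μ ν).mul_left (|v μ| * |v ν|))
  have h2e : ∀ μ ν, Summable fun z => |v μ * v ν * P μ ν z| * (∑ i, k i * z i) ^ 2 := fun μ ν => by
    have hb : Summable fun z => |v μ| * |v ν| * ((∑ i, |k i|) ^ 2 * (|P μ ν z| * size z ^ 3)) := ((hP μ ν).mul_left _).mul_left _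
    refine Summable.of_nonneg_of_le (fun z => by positivity) (fun z => ?_) hb
    rw [abs_mul, abs_mul]
    have hs : size z ^ 2 ≤ size z ^ 3 := pow_le_pow_right₀ (one_le_size z) (by norm_num)
    calc |v μ| * |v ν| * |P μ ν z| * (∑ i, k i * z i) ^ 2 ≤ |v μ| * |v ν| * |P μ ν z| * ((∑ i, |k i|) ^ 2 * size z ^ 2) :=
          mul_le_mul_of_nonneg_left (sq_phase_le k z) (by positivity)
      _ ≤ |v μ| * |v ν| * |P μ ν z| * ((∑ i, |k i|) ^ 2 * size z ^ 3) := by gcongr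
      _ = _ := by ring
  refine tendsto_tsum_cos_phase_div_sq _ k ?_ ?_ ?_
  · refine Summable.of_nonneg_of_le (fun z => abs_nonneg _) (fun z => (Finset.abs_sum_le_sum_abs _ _).trans (Finset.sum_le_sum fun μ _ => Finset.abs_sum_le_sum_abs _ _)) ?_
    exact summable_sum fun μ _ => summable_sum fun ν _ => habs μ ν
  · have hb : Summable fun z => ∑ μ, ∑ ν, |v μ * v ν * P μ ν z| * (∑ i, k i * z i) ^ 2 := summable_sum fun μ _ => summable_sum fun ν _ => h2e μ ν
    refine Summable.of_nonneg_of_le (fun z => by positivity) (fun z => ?_) hb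
    calc |∑ μ, ∑ ν, v μ * v ν * P μ ν z| * (∑ i, k i * z i) ^ 2 ≤ (∑ μ, ∑ ν, |v μ * v ν * P μ ν z|) * (∑ i, k i * z i) ^ 2 :=
          mul_le_mul_of_nonneg_right ((Finset.abs_sum_le_sum_abs _ _).trans (Finset.sum_le_sum fun μ _ => Finset.abs_sum_le_sum_abs _ _)) (sq_nonneg _)
      _ = ∑ μ, ∑ ν, |v μ * v ν * P μ ν z| * (∑ i, k i * z i) ^ 2 := by simp_rw [Finset.sum_mul]
  · rw [Summable.tsum_finsetSum fun μ _ => summable_sum fun ν _ => (habs μ ν).of_abs]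
    refine Finset.sum_eq_zero fun μ _ => ?_
    rw [Summable.tsum_finsetSum fun ν _ => (habs μ ν).of_abs]
    refine Finset.sum_eq_zero fun ν _ => ?_
    simp_rw [mul_assoc]
    rw [tsum_mul_left, tsum_mul_left, tsum_eq_zero_of_ward hP hT μ ν, mul_zero, mul_zero]

/-! ## §3 THE TRACE GERM ALONG AN AXIS: `(Σ_ν Σ_z P_{νν}(z) cos(p z_α)) ∕ p² → Σ_{ν ≠ α} β_{αν}`; its axis average is the axis-order-blind trace scalar of rows 88–90 -/

/-- [folklore] The longitudinal diagonal entry is FLAT at zero momentum: `(Σ_z P_{αα}(z) cos(p z_α)) ∕ p² → 0` ((5.9): `Σ_z P_{αα}(z) z_α² = 0`, leaf-01's `sqMoment_self_eq_zero_of_ward`). -/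
theorem tendsto_diag_cos_div_sq_self {P : B12Beta.Kernel d} (hP : MomentSummable P 3) (hT : WardTransversal P) (α : Fin d) :
    Tendsto (fun p : ℝ => (∑' z, P α α z * Real.cos (p * z α)) / p ^ 2) (𝓝[≠] 0) (𝓝 0) := by
  have h := tendsto_tsum_cos_div_sq (P α α) α (hP.summable_abs α α) (hP.summable_abs_mul_sq α α α) (tsum_eq_zero_of_ward hP hT α α)
  rwa [sqMoment_self_eq_zero_of_ward hP hT α α, mul_zero] at h

/-- [folklore] **THE TRACE GERM ALONG THE AXIS `α`**: under (5.9) + (5.8) + summable third moments, `(Σ_ν Σ_z P_{νν}(z) cos(p z_α)) ∕ p² → Σ_ν [ν ≠ α] β_{αν}` — the `α`-th ROW SUM of the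
matrix of (1.22) coefficients (the transverse diagonal entries contribute `β_{αν}` each, row 95; the longitudinal one is flat). -/
theorem tendsto_trace_cos_div_sq {P : B12Beta.Kernel d} (hP : MomentSummable P 3) (hT : WardTransversal P) (hS : IndexSymmetric P) (α : Fin d) :
    Tendsto (fun p : ℝ => (∑ ν, ∑' z, P ν ν z * Real.cos (p * z α)) / p ^ 2) (𝓝[≠] 0) (𝓝 (∑ ν, if ν = α then (0 : ℝ) else B12Beta.secondMoment P α ν)) := by
  simp_rw [Finset.sum_div]
  refine tendsto_finsetSum _ fun ν _ => ?_
  by_cases h : ν = α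
  · subst h; rw [if_pos rfl]; exact tendsto_diag_cos_div_sq_self hP hT ν
  · rw [if_neg h]; exact tendsto_diag_cos_div_sq_secondMoment hP hT hS (Ne.symm h)

/-- [folklore] The row sum of the (1.22) matrix is row 88's column identity read through (5.8): `Σ_ν [ν ≠ α] β_{αν} = −½ Σ_z P_{αα}(z)|z|²`. -/
theorem sum_offDiag_secondMoment_row {P : B12Beta.Kernel d} (hP : MomentSummable P 3) (hT : WardTransversal P) (hS : IndexSymmetric P) (α : Fin d) :
    (∑ ν, if ν = α then (0 : ℝ) else B12Beta.secondMoment P α ν) = -(1 / 2) * ∑' z, P α α z * ∑ μ, (z μ : ℝ) ^ 2 := by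
  rw [← sum_offDiag_secondMoment_col hP hT hS α]
  exact Finset.sum_congr rfl fun ν _ => by
    split_ifs with h
    · rfl
    · exact secondMoment_comm hS α ν

/-- [folklore] **… SO THE TRACE OF THE SYMBOL ALONG THE AXIS `α` HAS CURVATURE `−½ Σ_z P_{αα}(z)|z|²` AT ZERO MOMENTUM**: `(Σ_ν Σ_z P_{νν}(z) cos(p z_α)) ∕ p² → −½ Σ_z P_{αα}(z) Σ_μ z_μ²`. -/
theorem tendsto_trace_cos_div_sq_eq_longitudinalNormSq {P : B12Beta.Kernel d} (hP : MomentSummable P 3) (hT : WardTransversal P) (hS : IndexSymmetric P) (α : Fin d) :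
    Tendsto (fun p : ℝ => (∑ ν, ∑' z, P ν ν z * Real.cos (p * z α)) / p ^ 2) (𝓝[≠] 0) (𝓝 (-(1 / 2) * ∑' z, P α α z * ∑ μ, (z μ : ℝ) ^ 2)) := by
  rw [← sum_offDiag_secondMoment_row hP hT hS α]; exact tendsto_trace_cos_div_sq hP hT hS α

/-- [folklore] **THE AXIS-SUMMED TRACE GERM IS THE AXIS-ORDER-BLIND TRACE SCALAR** (rows 88–90): `Σ_α lim_{p→0} (Σ_ν Σ_z P_{νν}(z) cos(p z_α))∕p² = Σ_a Σ_b [a ≠ b] β_{ab} = −½ Σ_ν Σ_z P_{νν}(z)|z|²`. -/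
theorem tendsto_sum_trace_cos_div_sq {P : B12Beta.Kernel d} (hP : MomentSummable P 3) (hT : WardTransversal P) (hS : IndexSymmetric P) :
    Tendsto (fun p : ℝ => (∑ α, ∑ ν, ∑' z, P ν ν z * Real.cos (p * z α)) / p ^ 2) (𝓝[≠] 0) (𝓝 (-(1 / 2) * ∑ ν, ∑' z, P ν ν z * ∑ μ, (z μ : ℝ) ^ 2)) := by
  rw [← sum_offDiag_secondMoment_eq_trace hP hT hS]
  simp_rw [Finset.sum_div]
  refine tendsto_finsetSum _ fun α _ => ?_
  have h := tendsto_trace_cos_div_sq hP hT hS α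
  have e : (∑ ν, if ν = α then (0 : ℝ) else B12Beta.secondMoment P α ν) = ∑ b, if α = b then (0 : ℝ) else B12Beta.secondMoment P α b :=
    Finset.sum_congr rfl fun ν _ => by simp only [eq_comm]
  rw [e] at h
  simpa only [Finset.sum_div] using h


/-! ## §4 At the row-(D1) literals (`d = 4`): the trace of the level-`j` table along an axis has curvature `Σ_{ν≠α} β⁰_j(α,ν)` at zero momentum; summed over the axes, `−½ Σ_z tr T_j(z)|z|²` -/

section Literals

open Literature.MathematicalPhysics.QuantumFieldTheory.Balaban1983to89.Beta
open OneStepResolventKernel (JetData)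
open OneStepKernelFamily (TbalOf flipK secondMoment_flipK)
open Summit.QuantumFields.BalabanUV.Beta.MixedJetTablesPlug (JsBalAn1)
open Summit.QuantumFields.BalabanUV.Beta.CombChartJointEnd (JsB12CombShSym)
open Summit.QuantumFields.BalabanUV.Beta.SymmetrisedStepJets (SymTables)
open Summit.QuantumFields.BalabanUV.Beta.RowD1JointEnd (JsRowD1Pin)
open Summit.QuantumFields.BalabanUV.Beta.RowD1SymmetriesDischarged (symmetries_JsRowD1Pin)
open Summit.QuantumFields.BalabanUV.Gaps.D1IndexSymmetryDictionary (momentSummable_flipK_TbalOf)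
open Summit.QuantumFields.BalabanUV.Gaps.D1PinnedIndexSymmetry (indexSymmetric_flipK_TbalOf_JsBalAn1)
open Summit.QuantumFields.BalabanUV.Gaps.D1RecordIndexSymmetry (indexSymmetric_flipK_TbalOf_JsB12CombShSym)
open Summit.QuantumFields.BalabanUV.Gaps.D1CoDressedLongitudinalForm (indexSymmetric_flipK_TbalOf_JsRowD1Pin)
open Summit.QuantumFields.BalabanUV.Gaps.D1WardTraceForm (tsum_diag_normSq_flipK)
open Summit.QuantumFields.BalabanUV.Gaps.D1SymbolSmallMomentumGerm (tsum_diag_cos_flipK)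

variable {Lc : ℕ} [NeZero Lc]

/-- [folklore] **AN2's CHART-(II) LITERAL `JsRowD1Pin hLc N` (`Odd Lc`, `2 ≤ N`), HYPOTHESIS-FREE — THE AXIS-SUMMED TRACE GERM IS THE TRACE SCALAR**: with `T_j := TbalOf Lc (JsRowD1Pin hLc N) j`,
`(Σ_α Σ_ν Σ_z T_j(ν,ν,z) cos(p z_α)) ∕ p² → −½ Σ_ν Σ_z T_j(ν,ν,z)|z|²` (`= 2·Σ_{a<b} β⁰_j(a,b)` by row 93's level budget). -/
theorem tendsto_sum_trace_cos_div_sq_JsRowD1Pin (hLc : Odd Lc) {N : ℕ} (hN : 2 ≤ N) (j : ℕ) :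
    Tendsto (fun p : ℝ => (∑ α, ∑ ν, ∑' z, TbalOf Lc (JsRowD1Pin hLc N) j ν ν z * Real.cos (p * z α)) / p ^ 2) (𝓝[≠] 0)
      (𝓝 (-(1 / 2) * ∑ ν, ∑' z, TbalOf Lc (JsRowD1Pin hLc N) j ν ν z * ∑ μ, (z μ : ℝ) ^ 2)) := by
  have h := tendsto_sum_trace_cos_div_sq (momentSummable_flipK_TbalOf _ j 3) ((symmetries_JsRowD1Pin hLc hN).1 j) (indexSymmetric_flipK_TbalOf_JsRowD1Pin hLc N j)
  simpa only [tsum_diag_cos_flipK, tsum_diag_normSq_flipK] using h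

/-- [folklore] … and ALONG ONE AXIS `α` at `JsRowD1Pin`: `(Σ_ν Σ_z T_j(ν,ν,z) cos(p z_α)) ∕ p² → Σ_ν [ν ≠ α] β⁰_j(α,ν)` (the `α`-th row sum of the level-`j` (1.22) matrix). -/
theorem tendsto_trace_cos_div_sq_JsRowD1Pin (hLc : Odd Lc) {N : ℕ} (hN : 2 ≤ N) (j : ℕ) (α : Fin 4) :
    Tendsto (fun p : ℝ => (∑ ν, ∑' z, TbalOf Lc (JsRowD1Pin hLc N) j ν ν z * Real.cos (p * z α)) / p ^ 2) (𝓝[≠] 0)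
      (𝓝 (∑ ν, if ν = α then (0 : ℝ) else B12Beta.secondMoment (TbalOf Lc (JsRowD1Pin hLc N) j) α ν)) := by
  have h := tendsto_trace_cos_div_sq (momentSummable_flipK_TbalOf _ j 3) ((symmetries_JsRowD1Pin hLc hN).1 j) (indexSymmetric_flipK_TbalOf_JsRowD1Pin hLc N j) α
  simpa only [tsum_diag_cos_flipK, secondMoment_flipK] using h

variable {r : Fin (3 + 1) → ℕ}

/-- [folklore] **THE β-LEAD's PINNED FAMILY `JsBalAn1 …` UNDER `hW_j`** (any `1 ≤ Lc`, root, colours, `cE₂`, `cB`, `T`): the axis-summed trace germ of the level-`j` table is `−½ Σ_ν Σ_z T_j(ν,ν,z)|z|²`. -/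
theorem tendsto_sum_trace_cos_div_sq_JsBalAn1_of_hW (hLc : 1 ≤ Lc) (hr : r ∈ AffineAveraging.box (3 + 1) Lc) (cE cVH cΛ cE₂ cB : ℝ) (T : Fin 4 → Fin 4 → Fin 4 → Fin 4 → ℝ)
    (j : ℕ) (hW : WardTransversal (flipK (TbalOf Lc (JsBalAn1 hLc hr cE cVH cΛ cE₂ cB T) j))) :
    Tendsto (fun p : ℝ => (∑ α, ∑ ν, ∑' z, TbalOf Lc (JsBalAn1 hLc hr cE cVH cΛ cE₂ cB T) j ν ν z * Real.cos (p * z α)) / p ^ 2) (𝓝[≠] 0)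
      (𝓝 (-(1 / 2) * ∑ ν, ∑' z, TbalOf Lc (JsBalAn1 hLc hr cE cVH cΛ cE₂ cB T) j ν ν z * ∑ μ, (z μ : ℝ) ^ 2)) := by
  have h := tendsto_sum_trace_cos_div_sq (momentSummable_flipK_TbalOf _ j 3) hW (indexSymmetric_flipK_TbalOf_JsBalAn1 hLc hr cE cVH cΛ cE₂ cB T j)
  simpa only [tsum_diag_cos_flipK, tsum_diag_normSq_flipK] using h

/-- [folklore] … and along one axis at the pinned family under `hW_j`: `→ Σ_ν [ν ≠ α] β⁰_j(α,ν)`. -/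
theorem tendsto_trace_cos_div_sq_JsBalAn1_of_hW (hLc : 1 ≤ Lc) (hr : r ∈ AffineAveraging.box (3 + 1) Lc) (cE cVH cΛ cE₂ cB : ℝ) (T : Fin 4 → Fin 4 → Fin 4 → Fin 4 → ℝ)
    (j : ℕ) (hW : WardTransversal (flipK (TbalOf Lc (JsBalAn1 hLc hr cE cVH cΛ cE₂ cB T) j))) (α : Fin 4) :
    Tendsto (fun p : ℝ => (∑ ν, ∑' z, TbalOf Lc (JsBalAn1 hLc hr cE cVH cΛ cE₂ cB T) j ν ν z * Real.cos (p * z α)) / p ^ 2) (𝓝[≠] 0)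
      (𝓝 (∑ ν, if ν = α then (0 : ℝ) else B12Beta.secondMoment (TbalOf Lc (JsBalAn1 hLc hr cE cVH cΛ cE₂ cB T) j) α ν)) := by
  have h := tendsto_trace_cos_div_sq (momentSummable_flipK_TbalOf _ j 3) hW (indexSymmetric_flipK_TbalOf_JsBalAn1 hLc hr cE cVH cΛ cE₂ cB T j) α
  simpa only [tsum_diag_cos_flipK, secondMoment_flipK] using h

/-- [folklore] **THE b2b WALL's (III′) LITERAL `JsB12CombShSym hLc N tabs cΛ cB` UNDER `hW_j`** (every table record; `Odd Lc`): the axis-summed trace germ is `−½ Σ_ν Σ_z T_j(ν,ν,z)|z|²`. -/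
theorem tendsto_sum_trace_cos_div_sq_JsB12CombShSym_of_hW (hLc : Odd Lc) (N : ℕ) (tabs : SymTables 3 Lc) (cΛ cB : ℝ) (j : ℕ)
    (hW : WardTransversal (flipK (TbalOf Lc (JsB12CombShSym hLc N tabs cΛ cB) j))) :
    Tendsto (fun p : ℝ => (∑ α, ∑ ν, ∑' z, TbalOf Lc (JsB12CombShSym hLc N tabs cΛ cB) j ν ν z * Real.cos (p * z α)) / p ^ 2) (𝓝[≠] 0)
      (𝓝 (-(1 / 2) * ∑ ν, ∑' z, TbalOf Lc (JsB12CombShSym hLc N tabs cΛ cB) j ν ν z * ∑ μ, (z μ : ℝ) ^ 2)) := by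
  have h := tendsto_sum_trace_cos_div_sq (momentSummable_flipK_TbalOf _ j 3) hW (indexSymmetric_flipK_TbalOf_JsB12CombShSym hLc N tabs cΛ cB j)
  simpa only [tsum_diag_cos_flipK, tsum_diag_normSq_flipK] using h

/-- [folklore] … and along one axis at the (III′) literal under `hW_j`: `→ Σ_ν [ν ≠ α] β⁰_j(α,ν)`. -/
theorem tendsto_trace_cos_div_sq_JsB12CombShSym_of_hW (hLc : Odd Lc) (N : ℕ) (tabs : SymTables 3 Lc) (cΛ cB : ℝ) (j : ℕ)
    (hW : WardTransversal (flipK (TbalOf Lc (JsB12CombShSym hLc N tabs cΛ cB) j))) (α : Fin 4) :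
    Tendsto (fun p : ℝ => (∑ ν, ∑' z, TbalOf Lc (JsB12CombShSym hLc N tabs cΛ cB) j ν ν z * Real.cos (p * z α)) / p ^ 2) (𝓝[≠] 0)
      (𝓝 (∑ ν, if ν = α then (0 : ℝ) else B12Beta.secondMoment (TbalOf Lc (JsB12CombShSym hLc N tabs cΛ cB) j) α ν)) := by
  have h := tendsto_trace_cos_div_sq (momentSummable_flipK_TbalOf _ j 3) hW (indexSymmetric_flipK_TbalOf_JsB12CombShSym hLc N tabs cΛ cB j) α
  simpa only [tsum_diag_cos_flipK, secondMoment_flipK] using h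

end Literals

end Summit.QuantumFields.BalabanUV.Gaps.D1SymbolTraceGerm
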